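import Literature.Probability.Percolation.ConditionalPositiveAssociationProofs
import HarnessLib

/-!
# Folding fibres: a product of two `prodBernoulli` probabilities is a positive combination of
# configuration-versus-complement counts

Topic `Literature/Probability/Percolation` (the inhomogeneous product measure `μ = prodBernoulli p`
on `Set ι`, `ι` finite, of `Literature.Probability.LatticeModels`). Theorems only, no definitions,
no named facts.

For two independent copies `a, b` of `μ` group the pairs `(a, b)` by the set `M = a ∆ b` of
coordinates where they DISAGREE and by the common value `u = a \ M = b \ M` off `M`.  On such a
"fibre" the second copy is the first one flipped on `M`, `b = a ∆ M`, the pair weight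
`w(a) w(a ∆ M)` is constant (`= w(u) w(u ∆ M) = ∏_{e ∈ M} p_e (1 - p_e) ∏_{e ∉ M} (p_e² or (1-p_e)²)`),
and what is left is a COUNT: the number of `a` in the fibre with `a ∈ A` and `a ∆ M ∈ B`, i.e. — reading
the fibre as the cube `{0,1}^M` — the number of configurations `ω ⊆ M` lying in (the section of) `A`
whose complement `M ∖ ω` lies in (the section of) `B`:

* `prodBernoulli_real_mul_eq_sum_fibres` —
  `μ(A) μ(B) = ∑_M ∑_u w(u) w(u ∆ M) · #{a : a \ M = u, a ∈ A, a ∆ M ∈ B}`;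
* `prodBernoulli_real_mul_le_of_fibrewise` — hence, if for every fibre `(M, u)` the count for
  `(A₁, B₁)` is at most the count for `(A₂, B₂)`, then `μ(A₁) μ(B₁) ≤ μ(A₂) μ(B₂)` for EVERY parameter
  vector `p` ("fibrewise domination implies the product inequality for all weights").

This grouping is the *folding* of van den Berg–Fiebig (1987) and Reimer (2000) as formalised by
van den Berg–Gandolfi (2013, Def. 12: "The `(α;β,γ)`-folded version of `μ` … We call `M` the locked area
of the folding" — their locked area is the AGREEMENT set, the complement of our `M`), the partition
`{(ω, η) : ω + η = ξ}` of Merkl–Rolles (2013, proof of Thm. 1.6, eq. (3.68)), and, for connection events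
of bond percolation, exactly the edge-by-edge conditioning of Linusson (2011, Prop. 2.6: "in case (1)
contract `e`, in case (3) delete `e` and in case (2) leave `e` in the graph and remember that it now
appears either upstairs or downstairs … `P(x ↔ y) = p_e² P_{H₁} + 2 p_e(1-p_e) P_{H₂} + (1-p_e)² P_{H₃}`",
whose `p`-free Model `E₃` — "every edge in `G` is colored either red or blue with equal probability" —
is the all-disagree fibre `M = E`).  In the tree the same computation is carried out inside the proof
of `reimer_weighted_cube` (`InequalitiesProofs.lean`, Reimer's inequality from the flip lemma); this
file isolates it as a reusable identity for arbitrary pairs of events.  Equivalently (harness notes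
on the tripod exchange, 2026-08): `μ(A₂)μ(B₂) − μ(A₁)μ(B₁)` is the polynomial in `p` whose Bernstein
coefficients in multidegree `(2,…,2)` are the fibre count differences, so the corollary is the
statement "Bernstein-nonnegative ⇒ nonnegative on `[0,1]^ι`" for these polynomials.

## References

* S. Linusson, *On percolation and the bunkbed conjecture*, Combin. Probab. Comput. 20 (2011)
  103–117, Model `E₃^T` and Proposition 2.6 [Linusson2011].
* J. van den Berg, A. Gandolfi, *BK-type inequalities and generalized random-cluster representations*,
  Probab. Theory Related Fields 157 (2013) 157–181, §3 Def. 12 and the display in the proof of Thm. 13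
  [VandenbergGandolfi2012].
* F. Merkl, S. Rolles, *Perturbation analysis of the van den Berg Kesten inequality for determinantal
  probability measures*, Electron. J. Probab. 18 (2013), proof of Thm. 1.6, eq. (3.68) [MerklRolles2013].

## Mathlib / tree

Tree: `BHK2006.weight`, `BHK2006.integral_prodBernoulli_eq_sum`, `DecisionTree.ind`
(`ConditionalPositiveAssociationProofs.lean`, `DecisionTreeBK.lean`). Mathlib: `symmDiff` on `Set`,
`Finset.sum_fiberwise`, `Equiv.sum_comp`, `Finset.sum_boole`.
-/

noncomputable section

open MeasureTheory Set
open scoped symmDiff Classical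
open Literature.Probability.LatticeModels (prodBernoulli)

namespace Literature.Probability.Percolation

variable {ι : Type*} [Fintype ι]

open BHK2006 DecisionTree

/-- On the fibre `{a | a \ M = u}` the folded pair weight `w(a) · w(a ∆ M)` is constant: each
coordinate of `M` contributes `p_e (1 - p_e)` and each coordinate off `M` contributes `p_e²` or
`(1 - p_e)²` according to `u`. [cite: VandenbergGandolfi2012, §3 Def. 12 (the normalisation `Z` of the
folded measure)] -/
theorem weight_mul_weight_symmDiff_eq (w : ι → ℝ) {M u a : Set ι} (ha : a \ M = u) :
    weight w a * weight w (a ∆ M) = weight w u * weight w (u ∆ M) := by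
  unfold weight
  rw [← Finset.prod_mul_distrib, ← Finset.prod_mul_distrib]
  refine Finset.prod_congr rfl fun e _ => ?_
  have hu : e ∈ u ↔ e ∈ a ∧ e ∉ M := by rw [← ha]; exact Set.mem_sdiff e
  by_cases hM : e ∈ M <;> by_cases hea : e ∈ a <;>
    simp [Set.mem_symmDiff, hM, hea, hu, mul_comm]

/-- **Folding identity on the weighted cube** (van den Berg–Fiebig 1987 / Reimer 2000 grouping;
van den Berg–Gandolfi 2013 Def. 12 and proof of Thm. 13; Merkl–Rolles 2013 eq. (3.68)).  For ANY weights
`w : ι → ℝ` and events `A, B ⊆ Set ι`: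
`(∑_a w(a) 1_A(a)) (∑_b w(b) 1_B(b)) = ∑_M ∑_u w(u) w(u ∆ M) · #{a | a \ M = u ∧ a ∈ A ∧ a ∆ M ∈ B}`
(`w(a) = BHK2006.weight w a = ∏_e (w_e if e ∈ a else 1 - w_e)`, `1_A = DecisionTree.ind A`); `M` is the
disagreement set of the pair and `u` its common value off `M` (terms with `u ∩ M ≠ ∅` vanish).
[cite: VandenbergGandolfi2012, §3 Def. 12 and proof of Thm. 13] [cite: MerklRolles2013, eq. (3.68)] -/
theorem sum_weight_ind_mul_sum_eq_sum_fibres (w : ι → ℝ) (A B : Set (Set ι)) :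
    (∑ a : Set ι, weight w a * ind A a) * (∑ b : Set ι, weight w b * ind B b) =
      ∑ M : Set ι, ∑ u : Set ι, weight w u * weight w (u ∆ M) *
        ((Finset.univ.filter fun a : Set ι => a \ M = u ∧ a ∈ A ∧ a ∆ M ∈ B).card : ℝ) := by
  rw [Finset.sum_mul_sum]
  -- reindex the second copy by the disagreement set `M = a ∆ b` (an involution for fixed `a`)
  have step1 : ∀ a : Set ι, ∑ b : Set ι, weight w a * ind A a * (weight w b * ind B b) =
      ∑ M : Set ι, weight w a * ind A a * (weight w (a ∆ M) * ind B (a ∆ M)) := by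
    intro a
    let e : Equiv.Perm (Set ι) :=
      Function.Involutive.toPerm (fun M : Set ι => a ∆ M) (symmDiff_right_involutive a)
    calc ∑ b : Set ι, weight w a * ind A a * (weight w b * ind B b)
        = ∑ M : Set ι, weight w a * ind A a * (weight w (e M) * ind B (e M)) :=
          (Equiv.sum_comp e (fun b => weight w a * ind A a * (weight w b * ind B b))).symm
      _ = _ := Finset.sum_congr rfl fun M _ => rfl
  simp_rw [step1]
  rw [Finset.sum_comm]
  refine Finset.sum_congr rfl fun M _ => ?_
  -- group the first copy by its value `u = a \ M` off the disagreement set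
  rw [← Finset.sum_fiberwise Finset.univ (fun a : Set ι => a \ M)
    (fun a => weight w a * ind A a * (weight w (a ∆ M) * ind B (a ∆ M)))]
  refine Finset.sum_congr rfl fun u _ => ?_
  have hfib : ∀ a ∈ (Finset.univ.filter fun a : Set ι => a \ M = u),
      weight w a * ind A a * (weight w (a ∆ M) * ind B (a ∆ M)) =
        weight w u * weight w (u ∆ M) * (if a ∈ A ∧ a ∆ M ∈ B then (1 : ℝ) else 0) := by
    intro a ha
    have hau : a \ M = u := (Finset.mem_filter.1 ha).2
    rw [show weight w a * ind A a * (weight w (a ∆ M) * ind B (a ∆ M)) =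
        (weight w a * weight w (a ∆ M)) * (ind A a * ind B (a ∆ M)) by ring,
      weight_mul_weight_symmDiff_eq w hau]
    congr 1
    by_cases h1 : a ∈ A <;> by_cases h2 : a ∆ M ∈ B <;>
      simp [ind_of_mem, ind_of_not_mem, h1, h2]
  rw [Finset.sum_congr rfl hfib, ← Finset.mul_sum, Finset.sum_boole, Finset.filter_filter]

/-- `μ(C)` as a weighted sum of the indicator of `C`, `μ = prodBernoulli p` on a finite type.
[folklore] -/
theorem prodBernoulli_real_eq_sum_weight_ind (p : ι → unitInterval) (C : Set (Set ι)) :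
    (prodBernoulli p).real C = ∑ a : Set ι, weight (fun e => (p e : ℝ)) a * ind C a := by
  have hC : (fun a => ind C a) = C.indicator 1 := funext fun a => by
    by_cases ha : a ∈ C
    · rw [ind_of_mem ha, Set.indicator_of_mem ha, Pi.one_apply]
    · rw [ind_of_not_mem ha, Set.indicator_of_notMem ha]
  have h1 : ∫ a, ind C a ∂(prodBernoulli p) = (prodBernoulli p).real C := by
    rw [hC, integral_indicator_one MeasurableSet.of_discrete]
  rw [← h1, integral_prodBernoulli_eq_sum]

/-- **Folding identity for `prodBernoulli`** (same sources; for connection events of bond percolation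
this is the edge-by-edge conditioning of Linusson 2011 Prop. 2.6 — contract / delete / "exactly one of
`e₀, e₁` present").  For `μ = prodBernoulli p` on `Set ι` (`ι` finite) and arbitrary events `A, B`:
`μ(A) · μ(B) = ∑_{M} ∑_{u} w(u) w(u ∆ M) · #{a | a \ M = u ∧ a ∈ A ∧ a ∆ M ∈ B}` with
`w(a) = ∏_e (p_e if e ∈ a else 1 - p_e)`.
[cite: VandenbergGandolfi2012, §3 Def. 12 and proof of Thm. 13] [cite: MerklRolles2013, eq. (3.68)]
[cite: Linusson2011, Prop. 2.6] -/
theorem prodBernoulli_real_mul_eq_sum_fibres (p : ι → unitInterval) (A B : Set (Set ι)) :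
    (prodBernoulli p).real A * (prodBernoulli p).real B =
      ∑ M : Set ι, ∑ u : Set ι,
        weight (fun e => (p e : ℝ)) u * weight (fun e => (p e : ℝ)) (u ∆ M) *
          ((Finset.univ.filter fun a : Set ι => a \ M = u ∧ a ∈ A ∧ a ∆ M ∈ B).card : ℝ) := by
  rw [prodBernoulli_real_eq_sum_weight_ind p A, prodBernoulli_real_eq_sum_weight_ind p B]
  exact sum_weight_ind_mul_sum_eq_sum_fibres _ A B

/-- **Fibrewise domination implies the product inequality for all weights** (the principle behind
Linusson 2011 Prop. 2.6 — "Model `E₃` has the great advantage that we no longer have the parameter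
`p`" — and behind Reimer's passage from the flip lemma to his inequality).  If for every disagreement
set `M` and every `u` disjoint from `M` the number of `a` with `a \ M = u`, `a ∈ A₁`, `a ∆ M ∈ B₁` is at
most the number with `a \ M = u`, `a ∈ A₂`, `a ∆ M ∈ B₂`, then
`μ(A₁) μ(B₁) ≤ μ(A₂) μ(B₂)` for `μ = prodBernoulli p`, whatever `p : ι → [0,1]`.
[cite: Linusson2011, Prop. 2.6] [cite: VandenbergGandolfi2012, §3 (proof of Thm. 13 from Prop. 2)] -/
theorem prodBernoulli_real_mul_le_of_fibrewise (p : ι → unitInterval) (A₁ B₁ A₂ B₂ : Set (Set ι))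
    (h : ∀ M u : Set ι, Disjoint u M →
      (Finset.univ.filter fun a : Set ι => a \ M = u ∧ a ∈ A₁ ∧ a ∆ M ∈ B₁).card ≤
        (Finset.univ.filter fun a : Set ι => a \ M = u ∧ a ∈ A₂ ∧ a ∆ M ∈ B₂).card) :
    (prodBernoulli p).real A₁ * (prodBernoulli p).real B₁ ≤
      (prodBernoulli p).real A₂ * (prodBernoulli p).real B₂ := by
  rw [prodBernoulli_real_mul_eq_sum_fibres p A₁ B₁, prodBernoulli_real_mul_eq_sum_fibres p A₂ B₂]
  refine Finset.sum_le_sum fun M _ => Finset.sum_le_sum fun u _ => ?_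
  have hw0 : ∀ e, 0 ≤ (fun e => (p e : ℝ)) e := fun e => (p e).2.1
  have hw1 : ∀ e, (fun e => (p e : ℝ)) e ≤ 1 := fun e => (p e).2.2
  by_cases hd : Disjoint u M
  · exact mul_le_mul_of_nonneg_left (by exact_mod_cast h M u hd)
      (mul_nonneg (weight_nonneg hw0 hw1 _) (weight_nonneg hw0 hw1 _))
  · -- off the locus `u ∩ M = ∅` both fibres are empty
    have hempty : ∀ C D : Set (Set ι),
        (Finset.univ.filter fun a : Set ι => a \ M = u ∧ a ∈ C ∧ a ∆ M ∈ D) = ∅ := by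
      intro C D
      refine Finset.filter_eq_empty_iff.2 fun a _ ha => hd ?_
      rw [← ha.1]
      exact disjoint_sdiff_self_left
    rw [hempty, hempty]

/-- The same with SIGNED coefficients: a finite combination `∑ i, c i · μ(A i) μ(B i)` is nonnegative
for every parameter vector as soon as every fibre count combination `∑ i, c i · #{…}` is nonnegative
(the "Bernstein certificate" form used for the tripod exchange on small graphs, harness notes
2026-08; principle as above). [cite: Linusson2011, Prop. 2.6] -/
theorem prodBernoulli_sum_mul_nonneg_of_fibrewise {κ : Type*} (s : Finset κ) (c : κ → ℝ)
    (p : ι → unitInterval) (A B : κ → Set (Set ι))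
    (h : ∀ M u : Set ι, Disjoint u M →
      0 ≤ ∑ i ∈ s, c i *
        ((Finset.univ.filter fun a : Set ι => a \ M = u ∧ a ∈ A i ∧ a ∆ M ∈ B i).card : ℝ)) :
    0 ≤ ∑ i ∈ s, c i * ((prodBernoulli p).real (A i) * (prodBernoulli p).real (B i)) := by
  have hw0 : ∀ e, 0 ≤ (fun e => (p e : ℝ)) e := fun e => (p e).2.1
  have hw1 : ∀ e, (fun e => (p e : ℝ)) e ≤ 1 := fun e => (p e).2.2
  simp_rw [prodBernoulli_real_mul_eq_sum_fibres p, Finset.mul_sum]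
  rw [Finset.sum_comm]
  refine Finset.sum_nonneg fun M _ => ?_
  rw [Finset.sum_comm]
  refine Finset.sum_nonneg fun u _ => ?_
  have hZ : 0 ≤ weight (fun e => (p e : ℝ)) u * weight (fun e => (p e : ℝ)) (u ∆ M) :=
    mul_nonneg (weight_nonneg hw0 hw1 _) (weight_nonneg hw0 hw1 _)
  by_cases hd : Disjoint u M
  · calc (0 : ℝ) ≤ (weight (fun e => (p e : ℝ)) u * weight (fun e => (p e : ℝ)) (u ∆ M)) *
          ∑ i ∈ s, c i * ((Finset.univ.filter
            fun a : Set ι => a \ M = u ∧ a ∈ A i ∧ a ∆ M ∈ B i).card : ℝ) :=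
          mul_nonneg hZ (h M u hd)
      _ = _ := by
          rw [Finset.mul_sum]
          exact Finset.sum_congr rfl fun i _ => by ring
  · have hempty : ∀ C D : Set (Set ι),
        (Finset.univ.filter fun a : Set ι => a \ M = u ∧ a ∈ C ∧ a ∆ M ∈ D) = ∅ := by
      intro C D
      refine Finset.filter_eq_empty_iff.2 fun a _ ha => hd ?_
      rw [← ha.1]
      exact disjoint_sdiff_self_left
    refine Finset.sum_nonneg fun i _ => ?_
    rw [hempty]
    simp

end Literature.Probability.Percolation

end
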